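import Mathlib

/-!
# `Balaban1983to89.B5Eq123FaddeevPopov` — T. Bałaban, *Propagators and renormalization transformations for lattice
gauge theories. I*, Commun. Math. Phys. **95** (1984) 17–40 [Balaban1984PropagatorsI]: the Faddeev–Popov passage
(1.22) ⟹ (1.23), p. 21 [PDF 5], KERNEL-PROVED as finite-dimensional measure theory

statement-level skeleton of published theorems with citation tags; proofs where landed; nothing here is a claim about the Yang–Mills mass gap

PDF held: `paper:balaban1984-cmp95-propagators-rt-i` (journal page = PDF page + 16; (1.22)–(1.23) are p. 21 = PDF p. 5, READ AS
AN IMAGE on the page render `run/shared/lean/pub/pub-balaban/b2b-balaban-ref1/pages/1984-cmp95-propagators-rt-I/…-p005-x2.png`;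
the OCR text layer of this page is unusable for the displays).

WHAT IS REPRODUCED.  SKELETON row `B5.Eq1.23` (r02: «(1.22)–(1.23) [CLAIM] Faddeev–Popov … the integral identity (1.23):
— absent; cell flag G-B5-01»), taken from the SPARE list of PHASE2-TARGETS.md §G by Phase-2 seat p37 (gen 2); the typed
statement of record for the row is the B5 fold owner's (`B5SectBStatements`, r02 g2); this file PROVES the passage.  The print:

  «We want to remove the second term in the action by a gauge fixing term, so we introduce under the integral (1.17) the
   identity
        1 = ∫dλ′ δ(Q′_kλ′) exp(−(1/2α)⟨∂*A^{λ′}, ∂*A^{λ′}⟩) / ∫dλ δ(Q′_kλ) exp(−(1/2α)⟨∂*A^λ, ∂*A^λ⟩).            (1.22)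
   The restrictions on the gauge transformations given by the δ-functions above are chosen in such a way that all the
   expressions in the integral (1.17) with the exception of gauge fixing terms δ_Ax are invariant. Next we will calculate
   the expression in the numerator and denominator above and we will see that it is different from 0, but now let us
   transform (1.17). We change the order of integrations ∫dA∫dλ′…, and we make the gauge transformation −λ′ in the
   integral ∫dA…. We change the order of integrations again and we make a translation λ → λ + λ′ in the integral ∫dλ….
   We get
   (1.17) = z^{(k)} ∫dA δ(B − Q_kA)(∫dλ′ δ(Q′_kλ′)·δ_Ax(Q_{k−1}A + ∂^{L^{−1}}Q′_{k−1}λ′)·…·δ_Ax(A + ∂^ηλ′))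
            · exp(−(1/2α)⟨∂*A, ∂*A⟩)(∫dλ δ(Q′_kλ) exp(−(1/2α)⟨∂*A^λ, ∂*A^λ⟩))⁻¹ e^{−S^η(A)}
          = z′^{(k)} ∫dA δ(B − Q_kA) exp(−(1/2α)⟨∂*A, ∂*A⟩)·(∫dλ δ(Q′_kλ) exp(−(1/2α)⟨∂*A^λ, ∂*A^λ⟩))⁻¹ e^{−S^η(A)}.  (1.23)»

Here (1.17) is `((ST)^k e^{−S})(B) = z^{(k)} ∫dA δ(B − Q_kA) δ_Ax(Q_{k−1}A)·…·δ_Ax(A) e^{−S^η(A)}` (p. 20) and p. 20 states «The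
δ-function δ(B − Q_kA) is invariant with respect to gauge transformations λ satisfying Q′_kλ = 0».

TYPING (finite-dimensional measure theory; the δ-functions of LINEAR constraints are flat measures of the constraint
subspaces — the paper's own reading (1.40), p. 25, and the convention of `B5GaussSectC` / `B5Hk164Transl`):
* fields `A : V`; the constraint measure `dA δ(B − Q_kA)` is a measure `μ` on `V` INVARIANT under the restricted gauge
  transformations (§2, hypothesis `hTμ`; the companion `B5Eq123Constants` §2 constructs it as the translate of a Lebesgue
  measure of the fibre direction space and proves what is needed);
* the restricted gauge group `N = N(Q′_k) = {λ : Q′_kλ = 0}`, an additive group with its Haar (Lebesgue) measure `ν` = the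
  constraint measure `dλ δ(Q′_kλ)` (as in `B5GaussSectC.ZN`), acting on fields by `T λ A = A^λ` (`A^λ = A − ∂λ`, (1.4)) with
  `T 0 = id`, `T (λ + λ′) = T λ ∘ T λ′`, jointly measurable;
* the integrand of (1.17) = `f · g` with `g` gauge INVARIANT (`e^{−S^η}`; «all the expressions … with the exception of gauge
  fixing terms δ_Ax are invariant») and `f` the gauge-FIXING weight; the inserted weight `h(A) = exp(−(1/2α)⟨∂*A, ∂*A⟩)`
  (`B5Eq123Constants.feynmanW`) and the orbit integral `orbitInt ν T h A = ∫dλ δ(Q′_kλ) h(A^λ)` (§1) = the denominator of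
  (1.22), assumed «different from 0» and finite here (PROVED in `B5Eq123Constants` §3 from (1.24) = `B5GaussSectC`);
* weights are `ℝ≥0∞`-valued and integrals are lower Lebesgue integrals, so that Tonelli holds with NO integrability
  hypothesis — exactly the generality in which the printed manipulation is valid.

WHAT THIS FILE CERTIFIES (kernel, 0 `sorry`, axioms `propext`/`Classical.choice`/`Quot.sound`):
1. §1 `orbitInt_act`: the orbit integral is gauge invariant — the printed «translation λ → λ + λ′ in the integral ∫dλ»
   (right invariance of `ν`); `eq122`: (1.22) holds as soon as `0 < ∫dλ δ(Q′_kλ) h(A^λ) < ∞`.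
2. §2 `eq123_line1` — **the first line of (1.23)** for an ARBITRARY measurable gauge-fixing weight `f`:
   `∫ f g dμ = ∫ (∫dλ′ δ(Q′_kλ′) f(A^{−λ′})) · h(A) · (∫dλ δ(Q′_kλ) h(A^λ))⁻¹ · g(A) dμ(A)`, proved BY THE FOUR PRINTED STEPS
   (insert (1.22); Tonelli; the measure-preserving substitution `A ↦ A^{−λ′}`; Tonelli; `orbitInt_act`); `eq123` — **the
   second line**: if the λ′-integral of the gauge-fixing weight is a constant `c` (the content hidden in `z^{(k)} → z′^{(k)}`),
   then `∫ f g dμ = c · ∫ h (∫dλ δ(Q′_kλ) h(A^λ))⁻¹ g dμ`.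
3. §3 `eq123_measure_line1` / `eq123_measure` — the same two lines AT MEASURE LEVEL, for the printed gauge fixing: the
   product of axial δ-functions `δ_Ax(Q_{k−1}A)·…·δ_Ax(A)` (δ's of linear constraints) makes the left side of (1.17) an
   integral against a measure `P` (flat measure of the doubly constrained fibre), and the λ′-integral of (1.23) becomes
   the push-forward identity `orbit_*(ν ⊗ P) = c · μ`, `orbit (λ, A) = A^λ`.
4. The two constants of (1.23) live in the companion file `B5Eq123Constants` (same seat, filed together, no import
   between the two): (i) the push-forward identity of item 3 for LINEAR gauge conditions — if `(λ, s) ↦ s + Dλ` is a linear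
   bijection `N(Q′_k) × S ≃ F` (= `B5.HierGauge.complete` / `unique`, GAPS G-B5-01R) then Lebesgue ⊗ Lebesgue is pushed to
   `c ·` Lebesgue, `0 < c < ∞` (uniqueness of Haar measure; the Jacobian is not computed — the paper absorbs it in
   `z′^{(k)}`), also on the affine fibres `A₀ + F`; (ii) «different from 0»: the denominator of (1.22) equals
   `Z_N(α)·exp(−(1/2α)‖∂*A − R∂*A‖²) ∈ (0, ∞)` by (1.24) (`B5GaussSectC.integral_124`), and the (1.23) → (1.27) identification
   `h(A)·(∫dλ δ(Q′_kλ) h(A^λ))⁻¹ = 𝒢_α(∂*A)` (`B5GaussSectC.calG_eq_127`).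

WHAT IS NOT CERTIFIED HERE. (a) The identification of a particular typed carrier's `(ST)^k`, `Q_k`, `Q′_k`, `δ_Ax` with
`(V, μ, N, ν, T, f)` — i.e. the verification, for the B5 fold owner's typed (1.17)/(1.23) (`B5SectBStatements`, r02 g2,
in review at the time of writing) or for the V1 calculus (`LatticeFieldCalculus.gaugeShift`, p16's `B5Eq112RenormTransf`),
that the fibre measure is gauge invariant (`B5Eq123Constants` gives it for translates of Lebesgue measures) and that the
axial data map is bijective (`B5.HierGauge`); these instances are knitting items on top of this file.  (b) The value of the
constant `c` (a Jacobian; never printed).  (c) (1.24)–(1.28) (`B5GaussSectC`, used by name in the companion only).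

RELATION TO EXISTING TREE MATERIAL (not duplicated): `B5.HierGauge.*` (B5.lean §C.1) is the combinatorial lemma behind the
constant `c` and says itself that «the Faddeev–Popov bookkeeping of the Jacobians (constants z^{(k)} → z′^{(k)})» is not
formalised there; `B5Hk164Transl` HONEST SCOPE (i) names «the passage from the axial to the Landau gauge (1.23)/(1.46)» as
not typed; `B9Eq3121Measure` / `B9Eq3183` prove the DIFFERENT Faddeev–Popov step of [Balaban1985BackgroundPropagators]
Sect. D ((3.121): a δ_R gauge fixing integrated against dλ) with basis matrices — not imported, not restated.
`LatticeFieldCalculus.divergenceForm` is the real-valued Feynman-gauge exponent on the V1 calculus (cited (1.22) there).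

Unit `lit-balaban-p37` gen 2 (Phase-2 proof seat p37; literature-prover-lit-balaban-p37-g2-0), HOME
`run/shared/lean/pub/lit-balaban/` (STATUS: `lit-balaban-p37/STATUS.md`), 2026-08-21.  Tags: `[cite: Balaban1984PropagatorsI, …]`
on the transcribed steps; `[folklore]` on measure-theoretic helpers.  v1.1 (same day, append-only; v1 = p243942, commit
ccec719e3182, declarations byte-identical above §4): §4 — the Bochner (real-valued) forms `eq123_real`, `eq123_measure_real`.
-/

noncomputable section

open MeasureTheory
open scoped ENNReal NNReal

namespace Literature.MathematicalPhysics.QuantumFieldTheory.Balaban1983to89.B5Eq123FaddeevPopov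

/-! ## §1  The orbit integral `∫dλ δ(Q′_kλ) φ(A^λ)` over the restricted gauge group `N(Q′_k)` -/

section Orbit

variable {V : Type*} {N : Type*} [MeasurableSpace N]

/-- `∫dλ δ(Q′_kλ) φ(A^λ)` — the integral of a weight `φ` along the orbit of the field `A` under the restricted gauge
group `N(Q′_k) = {λ : Q′_kλ = 0}` acting by `T λ A = A^λ`; the constraint measure `δ(Q′_kλ)dλ` is the Haar (flat)
measure `ν` of `N(Q′_k)` (the paper's own reading (1.40), as in `B5GaussSectC.ZN`).  With the Feynman weight
`φ = exp(−(1/2α)⟨∂*·, ∂*·⟩)` this is the denominator (and numerator) of (1.22). [cite: Balaban1984PropagatorsI, (1.22) p.21] -/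
def orbitInt (ν : Measure N) (T : N → V → V) (φ : V → ℝ≥0∞) (A : V) : ℝ≥0∞ :=
  ∫⁻ l, φ (T l A) ∂ν

variable {ν : Measure N} {T : N → V → V}

/-- Unfolding lemma. [folklore] -/
private theorem orbitInt_def (φ : V → ℝ≥0∞) (A : V) : orbitInt ν T φ A = ∫⁻ l, φ (T l A) ∂ν := rfl

/-- (1.22): `1 = ∫dλ′ δ(Q′_kλ′) exp(−(1/2α)⟨∂*A^{λ′}, ∂*A^{λ′}⟩) / ∫dλ δ(Q′_kλ) exp(−(1/2α)⟨∂*A^λ, ∂*A^λ⟩)` — valid as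
soon as the orbit integral is «different from 0» (p. 21) and finite. [cite: Balaban1984PropagatorsI, (1.22) p.21] -/
theorem eq122 {h : V → ℝ≥0∞} {A : V} (h0 : orbitInt ν T h A ≠ 0) (htop : orbitInt ν T h A ≠ ⊤) :
    (1 : ℝ≥0∞) = orbitInt ν T h A / orbitInt ν T h A :=
  (ENNReal.div_self h0 htop).symm

section Meas

variable [MeasurableSpace V]

/-- For fixed `A`, `λ ↦ T λ A` is measurable when the action is jointly measurable. [folklore] -/
private theorem measurable_act_left (hTm : Measurable fun p : N × V => T p.1 p.2) (A : V) :
    Measurable fun l : N => T l A :=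
  hTm.comp (measurable_id.prodMk measurable_const)

/-- For fixed `λ`, `A ↦ T λ A` is measurable when the action is jointly measurable. [folklore] -/
private theorem measurable_act_right (hTm : Measurable fun p : N × V => T p.1 p.2) (l : N) :
    Measurable fun A : V => T l A :=
  hTm.comp (measurable_const.prodMk measurable_id)

/-- The orbit integral `A ↦ ∫dλ δ(Q′_kλ) h(A^λ)` (the denominator of (1.22)) is a measurable function of the field
(Tonelli), for a jointly measurable gauge action. [cite: Balaban1984PropagatorsI, (1.22) p.21] -/
theorem measurable_orbitInt [SFinite ν] (hTm : Measurable fun p : N × V => T p.1 p.2) {φ : V → ℝ≥0∞}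
    (hφ : Measurable φ) : Measurable (orbitInt ν T φ) := by
  have hu : Measurable (Function.uncurry fun (A : V) (l : N) => φ (T l A)) :=
    hφ.comp (hTm.comp measurable_swap)
  exact hu.lintegral_prod_right

end Meas

/-- p. 21, «we make a translation λ → λ + λ′ in the integral ∫dλ…»: the orbit integral is GAUGE INVARIANT,
`∫dλ δ(Q′_kλ) φ((A^{λ′})^λ) = ∫dλ δ(Q′_kλ) φ(A^λ)`, by the invariance of the Haar measure of `N(Q′_k)`.
[cite: Balaban1984PropagatorsI, (1.23) p.21] -/
theorem orbitInt_act [AddGroup N] [MeasurableAdd N] [ν.IsAddRightInvariant]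
    (hTadd : ∀ l l' A, T (l + l') A = T l (T l' A)) (φ : V → ℝ≥0∞) (l' : N) (A : V) :
    orbitInt ν T φ (T l' A) = orbitInt ν T φ A := by
  unfold orbitInt
  simp_rw [← hTadd]
  exact lintegral_add_right_eq_self (fun l => φ (T l A)) l'

end Orbit

/-! ## §2  (1.17) ⟹ (1.23): the Faddeev–Popov passage, function level (arbitrary gauge-fixing weight `f`) -/

section FP

variable {V : Type*} [MeasurableSpace V] {N : Type*} [AddGroup N] [MeasurableSpace N]
  [MeasurableAdd₂ N] [MeasurableNeg N]
  {μ : Measure V} [SFinite μ] {ν : Measure N} [SFinite ν] [ν.IsAddRightInvariant]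
  {T : N → V → V}

/-- **(1.23), first line — the Faddeev–Popov passage for an arbitrary gauge-fixing weight.**  Setting (p. 20–21):
`μ` = the constraint measure `dA δ(B − Q_kA)` (ANY measure invariant under the restricted gauge transformations
`A ↦ A^λ = T λ A`, `λ ∈ N(Q′_k)` — «The δ-function δ(B − Q_kA) is invariant with respect to gauge transformations λ
satisfying Q′_kλ = 0», p. 20), `ν` = `dλ δ(Q′_kλ)` (Haar measure of `N(Q′_k)`), `g` = the gauge-INVARIANT part of the
integrand of (1.17) (`e^{−S^η(A)}`), `f` = the gauge-FIXING part (`δ_Ax(Q_{k−1}A)·…·δ_Ax(A)`, here any weight),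
`h` = the inserted Feynman weight `exp(−(1/2α)⟨∂*A, ∂*A⟩)` with `0 < ∫dλ δ(Q′_kλ) h(A^λ) < ∞` («different from 0»).
Then, by exactly the printed steps — insert (1.22); «change the order of integrations ∫dA∫dλ′»; «make the gauge
transformation −λ′ in the integral ∫dA»; «change the order of integrations again»; «make a translation λ → λ + λ′
in the integral ∫dλ» —
`∫dA δ(B−Q_kA) f(A) g(A) = ∫dA δ(B−Q_kA) (∫dλ′ δ(Q′_kλ′) f(A^{−λ′})) · h(A) · (∫dλ δ(Q′_kλ) h(A^λ))⁻¹ · g(A)`,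
with `f(A^{−λ′}) = δ_Ax(Q_{k−1}A + ∂^{L^{−1}}Q′_{k−1}λ′)·…·δ_Ax(A + ∂^ηλ′)` in the paper.
[cite: Balaban1984PropagatorsI, (1.23) p.21] -/
theorem eq123_line1
    (hT0 : ∀ A, T 0 A = A) (hTadd : ∀ l l' A, T (l + l') A = T l (T l' A))
    (hTm : Measurable fun p : N × V => T p.1 p.2) (hTμ : ∀ l, MeasurePreserving (T l) μ μ)
    {g f h : V → ℝ≥0∞} (hg : Measurable g) (hf : Measurable f) (hh : Measurable h)
    (hginv : ∀ l A, g (T l A) = g A)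
    (hZ0 : ∀ A, orbitInt ν T h A ≠ 0) (hZtop : ∀ A, orbitInt ν T h A ≠ ⊤) :
    ∫⁻ A, f A * g A ∂μ =
      ∫⁻ A, orbitInt ν (fun l => T (-l)) f A * h A * (orbitInt ν T h A)⁻¹ * g A ∂μ := by
  -- notation
  set Z : V → ℝ≥0∞ := orbitInt ν T h with hZdef
  have hZm : Measurable Z := measurable_orbitInt hTm hh
  have hTl : ∀ A, Measurable fun l : N => T l A := measurable_act_left hTm
  have hTr : ∀ l, Measurable fun A : V => T l A := measurable_act_right hTm
  -- (1.22) inserted under the integral: `f g = ∫dλ′ f g h(A^{λ′}) Z(A)⁻¹`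
  have step0 : ∀ A, f A * g A = ∫⁻ l', f A * g A * (h (T l' A) * (Z A)⁻¹) ∂ν := by
    intro A
    have hm1 : Measurable fun l' : N => h (T l' A) := hh.comp (hTl A)
    have hm : Measurable fun l' : N => h (T l' A) * (Z A)⁻¹ := hm1.mul_const _
    rw [lintegral_const_mul _ hm, lintegral_mul_const _ hm1]
    change f A * g A = f A * g A * (Z A * (Z A)⁻¹)
    rw [ENNReal.mul_inv_cancel (hZ0 A) (hZtop A), mul_one]
  -- joint measurability of the integrand `(A, λ′) ↦ f(A) g(A) h(A^{λ′}) Z(A)⁻¹`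
  have hF : Measurable fun p : V × N => f p.1 * g p.1 * (h (T p.2 p.1) * (Z p.1)⁻¹) :=
    ((hf.comp measurable_fst).mul (hg.comp measurable_fst)).mul
      ((hh.comp (hTm.comp measurable_swap)).mul (hZm.comp measurable_fst).inv)
  -- joint measurability of the transformed integrand `(λ′, A) ↦ f(A^{−λ′}) g(A) h(A) Z(A)⁻¹`
  have hG : Measurable fun p : N × V => f (T (-p.1) p.2) * (g p.2 * (h p.2 * (Z p.2)⁻¹)) := by
    have h1 : Measurable fun p : N × V => T (-p.1) p.2 :=
      hTm.comp ((measurable_fst.neg).prodMk measurable_snd)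
    exact (hf.comp h1).mul ((hg.comp measurable_snd).mul ((hh.comp measurable_snd).mul
      (hZm.comp measurable_snd).inv))
  calc ∫⁻ A, f A * g A ∂μ
      = ∫⁻ A, ∫⁻ l', f A * g A * (h (T l' A) * (Z A)⁻¹) ∂ν ∂μ := lintegral_congr step0
    -- «We change the order of integrations ∫dA∫dλ′»
    _ = ∫⁻ l', ∫⁻ A, f A * g A * (h (T l' A) * (Z A)⁻¹) ∂μ ∂ν :=
        lintegral_lintegral_swap hF.aemeasurable
    -- «and we make the gauge transformation −λ′ in the integral ∫dA»
    _ = ∫⁻ l', ∫⁻ A, f (T (-l') A) * (g A * (h A * (Z A)⁻¹)) ∂μ ∂ν := by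
        refine lintegral_congr fun l' => ?_
        have hm : Measurable fun A => f A * g A * (h (T l' A) * (Z A)⁻¹) :=
          (hf.mul hg).mul ((hh.comp (hTr l')).mul hZm.inv)
        refine ((hTμ (-l')).lintegral_comp hm).symm.trans (lintegral_congr fun A => ?_)
        -- `(A^{−λ′})^{λ′} = A`, `g` invariant, `Z` invariant («translation λ → λ + λ′ in ∫dλ»)
        have h1 : T l' (T (-l') A) = A := by rw [← hTadd, add_neg_cancel, hT0]
        have h2 : Z (T (-l') A) = Z A := orbitInt_act hTadd h (-l') A
        simp only [h1, h2, hginv]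
        ring
    -- «We change the order of integrations again»
    _ = ∫⁻ A, ∫⁻ l', f (T (-l') A) * (g A * (h A * (Z A)⁻¹)) ∂ν ∂μ :=
        lintegral_lintegral_swap hG.aemeasurable
    _ = ∫⁻ A, orbitInt ν (fun l => T (-l)) f A * h A * (Z A)⁻¹ * g A ∂μ := by
        refine lintegral_congr fun A => ?_
        have hm : Measurable fun l' : N => f (T (-l') A) := hf.comp ((hTl A).comp measurable_neg)
        rw [lintegral_mul_const _ hm, orbitInt_def]
        ring

/-- **(1.23), second line.**  If the Faddeev–Popov orbit integral of the gauge-fixing weight,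
`∫dλ′ δ(Q′_kλ′) f(A^{−λ′}) = ∫dλ′ δ(Q′_kλ′) δ_Ax(Q_{k−1}A + ∂^{L^{−1}}Q′_{k−1}λ′)·…·δ_Ax(A + ∂^ηλ′)`, is a constant `c`
independent of `A` (for the axial δ-functions this is the hierarchical block-axial gauge lemma `B5.HierGauge.complete`
/ `unique`, measure form in `B5Eq123Constants.map_orbitLin_eq_smul`), then
`∫dA δ(B−Q_kA) f(A) g(A) = c · ∫dA δ(B−Q_kA) h(A) (∫dλ δ(Q′_kλ) h(A^λ))⁻¹ g(A)` — the printed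
`= z′^{(k)} ∫dA δ(B − Q_kA) exp(−(1/2α)⟨∂*A, ∂*A⟩)(∫dλ δ(Q′_kλ) exp(−(1/2α)⟨∂*A^λ, ∂*A^λ⟩))⁻¹ e^{−S^η(A)}` with
`z′^{(k)} = z^{(k)}·c`. [cite: Balaban1984PropagatorsI, (1.23) p.21] -/
theorem eq123
    (hT0 : ∀ A, T 0 A = A) (hTadd : ∀ l l' A, T (l + l') A = T l (T l' A))
    (hTm : Measurable fun p : N × V => T p.1 p.2) (hTμ : ∀ l, MeasurePreserving (T l) μ μ)
    {g f h : V → ℝ≥0∞} (hg : Measurable g) (hf : Measurable f) (hh : Measurable h)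
    (hginv : ∀ l A, g (T l A) = g A)
    (hZ0 : ∀ A, orbitInt ν T h A ≠ 0) (hZtop : ∀ A, orbitInt ν T h A ≠ ⊤)
    {c : ℝ≥0∞} (hFP : ∀ A, orbitInt ν (fun l => T (-l)) f A = c) :
    ∫⁻ A, f A * g A ∂μ = c * ∫⁻ A, h A * (orbitInt ν T h A)⁻¹ * g A ∂μ := by
  rw [eq123_line1 hT0 hTadd hTm hTμ hg hf hh hginv hZ0 hZtop]
  have hm : Measurable fun A => h A * (orbitInt ν T h A)⁻¹ * g A :=
    (hh.mul (measurable_orbitInt hTm hh).inv).mul hg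
  rw [← lintegral_const_mul _ hm]
  refine lintegral_congr fun A => ?_
  rw [hFP A]
  ring

end FP

/-! ## §3  (1.17) ⟹ (1.23) at MEASURE level: the printed gauge fixing `δ_Ax(Q_{k−1}A)·…·δ_Ax(A)` is a product of
δ-functions of linear constraints, i.e. (with `δ(B − Q_kA)dA`) the flat measure `P` of a smaller affine fibre; the
λ′-integral of (1.23), `∫dλ′ δ(Q′_kλ′) δ_Ax(Q_{k−1}A + ∂^{L^{−1}}Q′_{k−1}λ′)·…·δ_Ax(A + ∂^ηλ′)`, is then the statement
that the orbit map `(λ, A) ↦ A^λ` pushes `dλ δ(Q′_kλ) ⊗ P` forward to a CONSTANT multiple of `δ(B − Q_kA)dA`. -/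

section FPMeasure

variable {V : Type*} [MeasurableSpace V] {N : Type*} [AddGroup N] [MeasurableSpace N]
  [MeasurableAdd₂ N]
  {ν : Measure N} [SFinite ν] [ν.IsAddRightInvariant]
  {T : N → V → V}

/-- **(1.23), first line, measure level.**  For ANY measure `P` on fields (the constrained measure
`dA δ(B − Q_kA) δ_Ax(Q_{k−1}A)·…·δ_Ax(A)` of (1.17)), any gauge-invariant weight `g` (`e^{−S^η}`) and any inserted weight
`h` with `0 < ∫dλ δ(Q′_kλ) h(A^λ) < ∞`:  `∫ g dP = ∫ h(A)·(∫dλ δ(Q′_kλ) h(A^λ))⁻¹·g(A) d(orbit_*(ν ⊗ P))(A)`, where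
`orbit (λ, A) = A^λ` — insert (1.22), Tonelli, and the gauge invariance of `g` and of the orbit integral (translation
`λ → λ + λ′`). [cite: Balaban1984PropagatorsI, (1.23) p.21] -/
theorem eq123_measure_line1 (P : Measure V) [SFinite P]
    (hTadd : ∀ l l' A, T (l + l') A = T l (T l' A))
    (hTm : Measurable fun p : N × V => T p.1 p.2)
    {g h : V → ℝ≥0∞} (hg : Measurable g) (hh : Measurable h)
    (hginv : ∀ l A, g (T l A) = g A)
    (hZ0 : ∀ A, orbitInt ν T h A ≠ 0) (hZtop : ∀ A, orbitInt ν T h A ≠ ⊤) :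
    ∫⁻ A, g A ∂P =
      ∫⁻ A, h A * (orbitInt ν T h A)⁻¹ * g A ∂((ν.prod P).map fun p : N × V => T p.1 p.2) := by
  set Z : V → ℝ≥0∞ := orbitInt ν T h with hZdef
  have hZm : Measurable Z := measurable_orbitInt hTm hh
  have hTl : ∀ A, Measurable fun l : N => T l A := measurable_act_left hTm
  have hI : Measurable fun A => h A * (Z A)⁻¹ * g A := (hh.mul hZm.inv).mul hg
  -- the integrand after the orbit map, `(λ, A) ↦ h(A^λ) Z(A^λ)⁻¹ g(A^λ) = h(A^λ) Z(A)⁻¹ g(A)`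
  have hJ : Measurable fun p : N × V => h (T p.1 p.2) * (Z p.2)⁻¹ * g p.2 :=
    ((hh.comp hTm).mul (hZm.comp measurable_snd).inv).mul (hg.comp measurable_snd)
  symm
  calc ∫⁻ A, h A * (Z A)⁻¹ * g A ∂((ν.prod P).map fun p : N × V => T p.1 p.2)
      = ∫⁻ p, h (T p.1 p.2) * (Z (T p.1 p.2))⁻¹ * g (T p.1 p.2) ∂(ν.prod P) := lintegral_map hI hTm
    _ = ∫⁻ p, h (T p.1 p.2) * (Z p.2)⁻¹ * g p.2 ∂(ν.prod P) := by
        refine lintegral_congr fun p => ?_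
        rw [hginv, show Z (T p.1 p.2) = Z p.2 from orbitInt_act hTadd h p.1 p.2]
    _ = ∫⁻ l, ∫⁻ A, h (T l A) * (Z A)⁻¹ * g A ∂P ∂ν := lintegral_prod _ hJ.aemeasurable
    _ = ∫⁻ A, ∫⁻ l, h (T l A) * (Z A)⁻¹ * g A ∂ν ∂P :=
        lintegral_lintegral_swap hJ.aemeasurable
    _ = ∫⁻ A, g A ∂P := by
        refine lintegral_congr fun A => ?_
        have hm1 : Measurable fun l : N => h (T l A) := hh.comp (hTl A)
        have hm2 : Measurable fun l : N => h (T l A) * (Z A)⁻¹ := hm1.mul_const _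
        rw [lintegral_mul_const _ hm2, lintegral_mul_const _ hm1]
        change Z A * (Z A)⁻¹ * g A = g A
        rw [ENNReal.mul_inv_cancel (hZ0 A) (hZtop A), one_mul]

/-- **(1.23), second line, measure level.**  If the orbit map pushes `dλ δ(Q′_kλ) ⊗ P` forward to `c · μ`
(`μ` = `dA δ(B − Q_kA)`; this IS the λ′-integration of the axial δ-functions — `B5Eq123Constants.map_orbit_affine_eq_smul`
computes it for linear gauge conditions), then `∫ g dP = c · ∫ h (∫dλ δ(Q′_kλ) h(A^λ))⁻¹ g dμ`:
`(1.17) = z′^{(k)} ∫dA δ(B − Q_kA) exp(−(1/2α)⟨∂*A, ∂*A⟩)(∫dλ δ(Q′_kλ) exp(−(1/2α)⟨∂*A^λ, ∂*A^λ⟩))⁻¹ e^{−S^η(A)}`.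
[cite: Balaban1984PropagatorsI, (1.23) p.21] -/
theorem eq123_measure (P : Measure V) [SFinite P] (μ : Measure V) (c : ℝ≥0∞)
    (hTadd : ∀ l l' A, T (l + l') A = T l (T l' A))
    (hTm : Measurable fun p : N × V => T p.1 p.2)
    {g h : V → ℝ≥0∞} (hg : Measurable g) (hh : Measurable h)
    (hginv : ∀ l A, g (T l A) = g A)
    (hZ0 : ∀ A, orbitInt ν T h A ≠ 0) (hZtop : ∀ A, orbitInt ν T h A ≠ ⊤)
    (hFP : (ν.prod P).map (fun p : N × V => T p.1 p.2) = c • μ) :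
    ∫⁻ A, g A ∂P = c * ∫⁻ A, h A * (orbitInt ν T h A)⁻¹ * g A ∂μ := by
  rw [eq123_measure_line1 P hTadd hTm hg hh hginv hZ0 hZtop, hFP, lintegral_smul_measure, smul_eq_mul]

end FPMeasure

/-! ## §4 (v1.1, append-only)  The same identities for REAL-valued non-negative weights and Bochner integrals
(the form in which the cell's statement files type `∫dA δ(…)ρ(A)` — `B5Hk164Transl.int147`, `B5GaussSectC.ZN`):
obtained from §§2–3 by `∫ ρ = (∫⁻ ofReal ρ).toReal` for `ρ ≥ 0`; no integrability hypothesis is needed (both sides are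
then `0` together). -/

section Real

variable {V : Type*} [MeasurableSpace V] {N : Type*} [AddGroup N] [MeasurableSpace N]
  [MeasurableAdd₂ N] [MeasurableNeg N]
  {μ : Measure V} [SFinite μ] {ν : Measure N} [SFinite ν] [ν.IsAddRightInvariant]
  {T : N → V → V}

omit [AddGroup N] [MeasurableAdd₂ N] [MeasurableNeg N] [SFinite ν] [ν.IsAddRightInvariant] in
/-- The Bochner orbit integral of a real weight `h ≥ 0` is the real part of the `ℝ≥0∞` one. [folklore] -/
private theorem orbitInt_ofReal_toReal (hTm : Measurable fun p : N × V => T p.1 p.2)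
    {h : V → ℝ} (hh : Measurable h) (hh0 : ∀ A, 0 ≤ h A) (A : V) :
    (orbitInt ν T (fun A => ENNReal.ofReal (h A)) A).toReal = ∫ l, h (T l A) ∂ν := by
  have hm : Measurable fun l : N => h (T l A) := hh.comp (measurable_act_left hTm A)
  rw [integral_eq_lintegral_of_nonneg_ae (Filter.Eventually.of_forall fun l => hh0 _) hm.aestronglyMeasurable]
  rfl

/-- **(1.23), second line, for real non-negative weights (Bochner form).**  With `f, g, h ≥ 0` real, `g` gauge invariant,
`0 < ∫dλ δ(Q′_kλ) h(A^λ) < ∞`, and the λ′-integral of `f` equal to a finite constant `c`: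
`∫ f g dμ = c · ∫ h(A) (∫ h(A^λ) dν(λ))⁻¹ g(A) dμ(A)`. [cite: Balaban1984PropagatorsI, (1.23) p.21] -/
theorem eq123_real
    (hT0 : ∀ A, T 0 A = A) (hTadd : ∀ l l' A, T (l + l') A = T l (T l' A))
    (hTm : Measurable fun p : N × V => T p.1 p.2) (hTμ : ∀ l, MeasurePreserving (T l) μ μ)
    {g f h : V → ℝ} (hg : Measurable g) (hf : Measurable f) (hh : Measurable h)
    (hg0 : ∀ A, 0 ≤ g A) (hf0 : ∀ A, 0 ≤ f A) (hh0 : ∀ A, 0 ≤ h A)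
    (hginv : ∀ l A, g (T l A) = g A)
    (hZ0 : ∀ A, orbitInt ν T (fun A => ENNReal.ofReal (h A)) A ≠ 0)
    (hZtop : ∀ A, orbitInt ν T (fun A => ENNReal.ofReal (h A)) A ≠ ⊤)
    {c : ℝ≥0∞} (hFP : ∀ A, orbitInt ν (fun l => T (-l)) (fun A => ENNReal.ofReal (f A)) A = c) :
    ∫ A, f A * g A ∂μ = c.toReal * ∫ A, h A * (∫ l, h (T l A) ∂ν)⁻¹ * g A ∂μ := by
  set Z : V → ℝ≥0∞ := orbitInt ν T (fun A => ENNReal.ofReal (h A)) with hZdef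
  have hge : Measurable fun A => ENNReal.ofReal (g A) := ENNReal.measurable_ofReal.comp hg
  have hfe : Measurable fun A => ENNReal.ofReal (f A) := ENNReal.measurable_ofReal.comp hf
  have hhe : Measurable fun A => ENNReal.ofReal (h A) := ENNReal.measurable_ofReal.comp hh
  have hZm : Measurable Z := measurable_orbitInt hTm hhe
  have key := eq123 (μ := μ) hT0 hTadd hTm hTμ hge hfe hhe (fun l A => by rw [hginv]) hZ0 hZtop hFP
  -- the real orbit integral
  have hZr : ∀ A, ∫ l, h (T l A) ∂ν = (Z A).toReal := fun A =>
    (orbitInt_ofReal_toReal hTm hh hh0 A).symm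
  have hZr_pos : ∀ A, 0 < ∫ l, h (T l A) ∂ν := fun A => by
    rw [hZr]; exact ENNReal.toReal_pos (hZ0 A) (hZtop A)
  -- left side
  have hL : ∫ A, f A * g A ∂μ = (∫⁻ A, ENNReal.ofReal (f A) * ENNReal.ofReal (g A) ∂μ).toReal := by
    rw [integral_eq_lintegral_of_nonneg_ae (Filter.Eventually.of_forall fun A => mul_nonneg (hf0 A) (hg0 A))
      (hf.mul hg).aestronglyMeasurable]
    congr 1
    refine lintegral_congr fun A => ?_
    rw [ENNReal.ofReal_mul (hf0 A)]
  -- right side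
  have hR : ∫ A, h A * (∫ l, h (T l A) ∂ν)⁻¹ * g A ∂μ =
      (∫⁻ A, ENNReal.ofReal (h A) * (Z A)⁻¹ * ENNReal.ofReal (g A) ∂μ).toReal := by
    have hm : Measurable fun A => h A * (∫ l, h (T l A) ∂ν)⁻¹ * g A := by
      have : Measurable fun A => (Z A).toReal := hZm.ennreal_toReal
      simp_rw [hZr]
      exact (hh.mul this.inv).mul hg
    rw [integral_eq_lintegral_of_nonneg_ae (Filter.Eventually.of_forall fun A =>
      mul_nonneg (mul_nonneg (hh0 A) (inv_nonneg.2 (hZr_pos A).le)) (hg0 A)) hm.aestronglyMeasurable]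
    congr 1
    refine lintegral_congr fun A => ?_
    rw [ENNReal.ofReal_mul (mul_nonneg (hh0 A) (inv_nonneg.2 (hZr_pos A).le)),
      ENNReal.ofReal_mul (hh0 A), ENNReal.ofReal_inv_of_pos (hZr_pos A), hZr,
      ENNReal.ofReal_toReal (hZtop A)]
  rw [hL, hR, key, ENNReal.toReal_mul]

omit [SFinite μ] [MeasurableNeg N] in
/-- **(1.23), second line, measure level, Bochner form.**  [cite: Balaban1984PropagatorsI, (1.23) p.21] -/
theorem eq123_measure_real (P : Measure V) [SFinite P] (c : ℝ≥0∞)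
    (hTadd : ∀ l l' A, T (l + l') A = T l (T l' A))
    (hTm : Measurable fun p : N × V => T p.1 p.2)
    {g h : V → ℝ} (hg : Measurable g) (hh : Measurable h) (hg0 : ∀ A, 0 ≤ g A) (hh0 : ∀ A, 0 ≤ h A)
    (hginv : ∀ l A, g (T l A) = g A)
    (hZ0 : ∀ A, orbitInt ν T (fun A => ENNReal.ofReal (h A)) A ≠ 0)
    (hZtop : ∀ A, orbitInt ν T (fun A => ENNReal.ofReal (h A)) A ≠ ⊤)
    (hFP : (ν.prod P).map (fun p : N × V => T p.1 p.2) = c • μ) :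
    ∫ A, g A ∂P = c.toReal * ∫ A, h A * (∫ l, h (T l A) ∂ν)⁻¹ * g A ∂μ := by
  set Z : V → ℝ≥0∞ := orbitInt ν T (fun A => ENNReal.ofReal (h A)) with hZdef
  have hge : Measurable fun A => ENNReal.ofReal (g A) := ENNReal.measurable_ofReal.comp hg
  have hhe : Measurable fun A => ENNReal.ofReal (h A) := ENNReal.measurable_ofReal.comp hh
  have hZm : Measurable Z := measurable_orbitInt hTm hhe
  have key := eq123_measure (ν := ν) P μ c hTadd hTm hge hhe (fun l A => by rw [hginv]) hZ0 hZtop hFP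
  have hZr : ∀ A, ∫ l, h (T l A) ∂ν = (Z A).toReal := fun A =>
    (orbitInt_ofReal_toReal hTm hh hh0 A).symm
  have hZr_pos : ∀ A, 0 < ∫ l, h (T l A) ∂ν := fun A => by
    rw [hZr]; exact ENNReal.toReal_pos (hZ0 A) (hZtop A)
  have hL : ∫ A, g A ∂P = (∫⁻ A, ENNReal.ofReal (g A) ∂P).toReal :=
    integral_eq_lintegral_of_nonneg_ae (Filter.Eventually.of_forall hg0) hg.aestronglyMeasurable
  have hR : ∫ A, h A * (∫ l, h (T l A) ∂ν)⁻¹ * g A ∂μ =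
      (∫⁻ A, ENNReal.ofReal (h A) * (Z A)⁻¹ * ENNReal.ofReal (g A) ∂μ).toReal := by
    have hm : Measurable fun A => h A * (∫ l, h (T l A) ∂ν)⁻¹ * g A := by
      have : Measurable fun A => (Z A).toReal := hZm.ennreal_toReal
      simp_rw [hZr]
      exact (hh.mul this.inv).mul hg
    rw [integral_eq_lintegral_of_nonneg_ae (Filter.Eventually.of_forall fun A =>
      mul_nonneg (mul_nonneg (hh0 A) (inv_nonneg.2 (hZr_pos A).le)) (hg0 A)) hm.aestronglyMeasurable]
    congr 1
    refine lintegral_congr fun A => ?_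
    rw [ENNReal.ofReal_mul (mul_nonneg (hh0 A) (inv_nonneg.2 (hZr_pos A).le)),
      ENNReal.ofReal_mul (hh0 A), ENNReal.ofReal_inv_of_pos (hZr_pos A), hZr,
      ENNReal.ofReal_toReal (hZtop A)]
  rw [hL, hR, key, ENNReal.toReal_mul]

end Real

end Literature.MathematicalPhysics.QuantumFieldTheory.Balaban1983to89.B5Eq123FaddeevPopov

end
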